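import Summits.ValiantsHypothesis.ValiantsHypothesis.Theorems.LacunarySymmetroidMatrixDescartesDoorA26WallBubblingBubblingRobustCountSecondOrder

/-!
# Real exponential sums: the ROBUST exponential Newton inequalities (ENS for limits of window-sharp families) — line `wall_bubbling`, W4 (file 4)

Helper for the line `Cruxes/DoorA26/Lines/wall_bubbling.lean` (stmt-ValiantsHypothesis-19979), obligation (M): the form of soundness-ledger item (v) that the
second-order sieve instrument (`Lines/wall_bubbling_M-sieve.md` §2.4 ENS, «USE: a far cluster K with n active classes carries n−1 zeros (saturation), so
its LIMIT coefficients are ENS-concave») actually consumes.  Seat val-sym-lift-p1 (g19), W4; `--supports stmt-ValiantsHypothesis-19979 --as helper`.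
Currency of the chain (`expSum a x t = Σᵢ aᵢe^{xᵢt}`, `classSum a x w`), window `[−R, R]`, coefficientwise/exponentwise convergent families
`(a ν, x ν) → (a₀, x₀)`.  Proved here (no multiplicities, no Hurwitz):
* `eventually_noZero_of_limit_ne` — if the limit sum has no zero on the window, neither has `g_ν` for large `ν` (the chain's `eventually_no_zero`
  with the single-class hypothesis replaced by its consequence);
* `eventually_card_le_one_of_twistLimit_ne` — if the limit of the `(d/dt − v)`-family `aᵢ(xᵢ − v)` has no zero on the window, `g_ν` has at most ONE
  zero there for large `ν` (Rolle);
* `three_term_ens_robust` — three active limit classes `u < v < w` and, frequently in `ν`, two distinct zeros of `g_ν` in the window ⇒ the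
  NON-STRICT weighted log-concavity `(w−u)·log c_v ≥ (w−v)·log c_u + (v−u)·log c_w` of the limit class sums (outer classes of opposite sign are
  impossible; same sign + failure of the inequality would make the limit zero-free — the AM–GM bound `amgm_lower_bound`);
* the `n`-class form `ens_concave_robust` (induction by `(d/dt − m)` steps at extreme active limit exponents) is the sequel file
  `…BubblingExpNewtonRobustAll`.
HONEST FRAMING.  Classical real analysis; a kernel version of an instrument lemma; (M)/(W) OPEN; nothing on `DoorA26`, `MatrixDescartes` (stmt-18050)
or VP ≠ VNP.  No definitions.
-/

-- `Summit.ValiantsHypothesis.ValiantsHypothesis.…` repeats a component by the D-0017 layout (single-conjunct summit); the name is mandated.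
set_option linter.dupNamespace false
set_option autoImplicit false

namespace Summit.ValiantsHypothesis.ValiantsHypothesis.Theorems.LacunarySymmetroidMatrixDescartes.WallBubbling.Bubbling

open Finset Filter Topology Real

variable {ι : Type*} [Fintype ι]

/-! ## 1. Zero-free limits -/

/-- joint continuity: along `ν → ∞` and `t_ν → t₀`, `g_ν(t_ν) → g₀(t₀)`. [folklore] -/
theorem tendsto_expSum_comp (a x : ℕ → ι → ℝ) (a₀ x₀ : ι → ℝ)
    (ha : ∀ i, Tendsto (fun ν => a ν i) atTop (𝓝 (a₀ i))) (hx : ∀ i, Tendsto (fun ν => x ν i) atTop (𝓝 (x₀ i)))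
    {φ : ℕ → ℕ} (hφ : Tendsto φ atTop atTop) {t : ℕ → ℝ} {t₀ : ℝ} (ht : Tendsto t atTop (𝓝 t₀)) :
    Tendsto (fun n => expSum (a (φ n)) (x (φ n)) (t n)) atTop (𝓝 (expSum a₀ x₀ t₀)) := by
  unfold expSum
  apply tendsto_finsetSum
  intro i _
  have h1 : Tendsto (fun n => a (φ n) i) atTop (𝓝 (a₀ i)) := (ha i).comp hφ
  have h2 : Tendsto (fun n => x (φ n) i) atTop (𝓝 (x₀ i)) := (hx i).comp hφ
  exact h1.mul ((continuous_exp.tendsto _).comp (h2.mul ht))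

/-- **zero-free limit ⇒ eventually zero-free** on a compact window. [folklore] -/
theorem eventually_noZero_of_limit_ne (a x : ℕ → ι → ℝ) (a₀ x₀ : ι → ℝ)
    (ha : ∀ i, Tendsto (fun ν => a ν i) atTop (𝓝 (a₀ i))) (hx : ∀ i, Tendsto (fun ν => x ν i) atTop (𝓝 (x₀ i)))
    (R : ℝ) (hne : ∀ t ∈ Set.Icc (-R) R, expSum a₀ x₀ t ≠ 0) :
    ∀ᶠ ν in atTop, ∀ t ∈ Set.Icc (-R) R, expSum (a ν) (x ν) t ≠ 0 := by
  by_contra H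
  have H' : ∃ᶠ ν in atTop, ∃ t ∈ Set.Icc (-R) R, expSum (a ν) (x ν) t = 0 := by
    rw [Filter.not_eventually] at H
    refine H.mono fun ν h => ?_
    by_contra h'
    apply h
    intro t ht h0
    exact h' ⟨t, ht, h0⟩
  obtain ⟨φ, hφ, hφP⟩ := Filter.extraction_of_frequently_atTop H'
  choose t ht h0 using hφP
  obtain ⟨t₀, ht₀, ψ, hψ, hlim⟩ := isCompact_Icc.tendsto_subseq ht
  have hsub : Tendsto (φ ∘ ψ) atTop atTop := (hφ.comp hψ).tendsto_atTop
  have key := tendsto_expSum_comp a x a₀ x₀ ha hx hsub hlim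
  have key2 : Tendsto (fun _ : ℕ => (0 : ℝ)) atTop (𝓝 (expSum a₀ x₀ t₀)) := key.congr (fun n => h0 (ψ n))
  exact hne t₀ ht₀ (tendsto_const_nhds_iff.mp key2).symm

/-- **at most one zero**: if the limit of the `(d/dt − v)`-family `aᵢ(xᵢ − v)` has no zero on the window, then `g_ν` has at most one zero in the
window for large `ν`. [this file] -/
theorem eventually_card_le_one_of_twistLimit_ne (a x : ℕ → ι → ℝ) (a₀ x₀ : ι → ℝ) (v : ℝ)
    (ha : ∀ i, Tendsto (fun ν => a ν i) atTop (𝓝 (a₀ i))) (hx : ∀ i, Tendsto (fun ν => x ν i) atTop (𝓝 (x₀ i)))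
    (R : ℝ) (hne : ∀ t ∈ Set.Icc (-R) R, expSum (fun i => a₀ i * (x₀ i - v)) x₀ t ≠ 0) :
    ∀ᶠ ν in atTop, ∀ Z : Finset ℝ, (∀ z ∈ Z, z ∈ Set.Icc (-R) R ∧ expSum (a ν) (x ν) z = 0) → Z.card ≤ 1 := by
  have hb : ∀ i, Tendsto (fun ν => a ν i * (x ν i - v) / 1) atTop (𝓝 (a₀ i * (x₀ i - v))) := by
    intro i
    have := (ha i).mul ((hx i).sub_const v)
    simpa using this
  have hlim := eventually_noZero_of_limit_ne (fun ν i => a ν i * (x ν i - v) / 1) x (fun i => a₀ i * (x₀ i - v)) x₀ hb hx R hne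
  filter_upwards [hlim] with ν hν Z hZ
  obtain ⟨Z', hcard, hZ'⟩ := card_zeros_le_card_zeros_twistDeriv_add_one (a ν) (x ν) v 1 (-R) R Z hZ
  have hZ'0 : Z'.card = 0 := by
    rw [Finset.card_eq_zero, Finset.eq_empty_iff_forall_notMem]
    intro z hz
    exact hν z (hZ' z hz).1 (hZ' z hz).2
  omega

/-! ## 2. Three terms -/

/-- the limit sum with exactly three active classes. [bookkeeping] -/
theorem expSum_eq_three_classes [DecidableEq ℝ] (a x : ι → ℝ) (u v w : ℝ) (huv : u ≠ v) (huw : u ≠ w) (hvw : v ≠ w)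
    (honly : ∀ s, classSum a x s ≠ 0 → s = u ∨ s = v ∨ s = w) (t : ℝ) :
    expSum a x t = classSum a x u * exp (u * t) + classSum a x v * exp (v * t) + classSum a x w * exp (w * t) := by
  rw [expSum_eq_sum_classes]
  -- split the class sum over the image into `{u,v,w} ∩ image` and the rest (which vanishes)
  have key : ∀ s, exp (s * t) * classSum a x s =
      (if s = u then classSum a x u * exp (u * t) else 0) + (if s = v then classSum a x v * exp (v * t) else 0) +
        (if s = w then classSum a x w * exp (w * t) else 0) := by
    intro s
    by_cases hs : classSum a x s = 0
    · by_cases h1 : s = u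
      · subst h1; rw [if_pos rfl, if_neg huv, if_neg huw, hs]; ring
      by_cases h2 : s = v
      · subst h2; rw [if_neg h1, if_pos rfl, if_neg hvw, hs]; ring
      by_cases h3 : s = w
      · subst h3; rw [if_neg h1, if_neg h2, if_pos rfl, hs]; ring
      rw [if_neg h1, if_neg h2, if_neg h3, hs]; ring
    · rcases honly s hs with rfl | rfl | rfl
      · rw [if_pos rfl, if_neg huv, if_neg huw]; ring
      · rw [if_neg (Ne.symm huv), if_pos rfl, if_neg hvw]; ring
      · rw [if_neg (Ne.symm huw), if_neg (Ne.symm hvw), if_pos rfl]; ring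
  rw [Finset.sum_congr rfl fun s _ => key s, Finset.sum_add_distrib, Finset.sum_add_distrib,
    Finset.sum_ite_eq' , Finset.sum_ite_eq', Finset.sum_ite_eq']
  -- a class outside the image has zero class sum
  have hout : ∀ s, s ∉ Finset.univ.image x → classSum a x s = 0 := by
    intro s hs
    unfold classSum
    refine Finset.sum_eq_zero fun i _ => ?_
    rw [if_neg]
    intro h
    exact hs (h ▸ Finset.mem_image_of_mem x (Finset.mem_univ i))
  by_cases hu : u ∈ Finset.univ.image x <;> by_cases hv : v ∈ Finset.univ.image x <;> by_cases hw : w ∈ Finset.univ.image x <;>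
    simp [hu, hv, hw, hout]

/-- **AM–GM lower bound**: for `a, b, p, q > 0` and every `t`, `(p+q) log (a e^{−pt} + b e^{qt}) ≥ (p+q) log((p+q)/(pq)) + q log(pa) + p log(qb)`.
[folklore: Jensen] -/
theorem amgm_lower_bound {a b p q : ℝ} (ha : 0 < a) (hb : 0 < b) (hp : 0 < p) (hq : 0 < q) (t : ℝ) :
    (p + q) * log ((p + q) / (p * q)) + q * log (p * a) + p * log (q * b) ≤ (p + q) * log (a * exp (-(p * t)) + b * exp (q * t)) := by
  have hpq : 0 < p + q := by linarith
  set θ : ℝ := q / (p + q) with hθ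
  set θ' : ℝ := p / (p + q) with hθ'
  have hθ0 : 0 < θ := div_pos hq hpq
  have hθ'0 : 0 < θ' := div_pos hp hpq
  have hθ1 : θ + θ' = 1 := by rw [hθ, hθ', ← add_div, add_comm]; exact div_self hpq.ne'
  have hX : 0 < p * a * exp (-(p * t)) * ((p + q) / (p * q)) := by positivity
  have hY : 0 < q * b * exp (q * t) * ((p + q) / (p * q)) := by positivity
  have hcomb : θ * (p * a * exp (-(p * t)) * ((p + q) / (p * q))) + θ' * (q * b * exp (q * t) * ((p + q) / (p * q))) =
      a * exp (-(p * t)) + b * exp (q * t) := by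
    rw [hθ, hθ']; field_simp
  have hJ := (strictConcaveOn_log_Ioi.concaveOn).2 hX hY hθ0.le hθ'0.le hθ1
  simp only [smul_eq_mul] at hJ
  rw [hcomb] at hJ
  have hval : θ * log (p * a * exp (-(p * t)) * ((p + q) / (p * q))) + θ' * log (q * b * exp (q * t) * ((p + q) / (p * q))) =
      log ((p + q) / (p * q)) + θ * log (p * a) + θ' * log (q * b) := by
    have hpa : 0 < p * a := mul_pos hp ha
    have hqb : 0 < q * b := mul_pos hq hb
    have hr : 0 < (p + q) / (p * q) := by positivity
    rw [log_mul (mul_pos hpa (exp_pos _)).ne' hr.ne', log_mul hpa.ne' (exp_pos _).ne', log_exp,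
      log_mul (mul_pos hqb (exp_pos _)).ne' hr.ne', log_mul hqb.ne' (exp_pos _).ne', log_exp]
    have : θ * (-(p * t)) + θ' * (q * t) = 0 := by rw [hθ, hθ']; field_simp; ring
    linear_combination this + Real.log ((p + q) / (p * q)) * hθ1
  rw [hval] at hJ
  have := mul_le_mul_of_nonneg_left hJ hpq.le
  rw [hθ, hθ'] at this
  have e : (p + q) * (log ((p + q) / (p * q)) + q / (p + q) * log (p * a) + p / (p + q) * log (q * b)) =
      (p + q) * log ((p + q) / (p * q)) + q * log (p * a) + p * log (q * b) := by field_simp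
  linarith

/-- **ROBUST THREE-TERM ENS.**  Coefficientwise/exponentwise convergent family whose limit has exactly the three active classes `u < v < w`; if
FREQUENTLY in `ν` the sum `g_ν` has two distinct zeros in the window `[−R, R]`, then the limit class sums satisfy the NON-STRICT weighted
log-concavity `(w−v)·log(|c_u|(v−u)(w−u)) + (v−u)·log(|c_w|(w−u)(w−v)) ≤ (w−u)·log(|c_v|(v−u)(w−v))`. [this file] -/
theorem three_term_ens_robust (a x : ℕ → ι → ℝ) (a₀ x₀ : ι → ℝ)
    (ha : ∀ i, Tendsto (fun ν => a ν i) atTop (𝓝 (a₀ i))) (hx : ∀ i, Tendsto (fun ν => x ν i) atTop (𝓝 (x₀ i)))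
    (u v w : ℝ) (huv : u < v) (hvw : v < w)
    (hU : classSum a₀ x₀ u ≠ 0) (hV : classSum a₀ x₀ v ≠ 0) (hW : classSum a₀ x₀ w ≠ 0)
    (honly : ∀ s, classSum a₀ x₀ s ≠ 0 → s = u ∨ s = v ∨ s = w) (R : ℝ)
    (hfreq : ∃ᶠ ν in atTop, ∃ t₁ t₂, t₁ ∈ Set.Icc (-R) R ∧ t₂ ∈ Set.Icc (-R) R ∧ t₁ ≠ t₂ ∧
      expSum (a ν) (x ν) t₁ = 0 ∧ expSum (a ν) (x ν) t₂ = 0) :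
    (w - v) * log (|classSum a₀ x₀ u| * ((v - u) * (w - u))) + (v - u) * log (|classSum a₀ x₀ w| * ((w - u) * (w - v))) ≤
      (w - u) * log (|classSum a₀ x₀ v| * ((v - u) * (w - v))) := by
  classical
  set cu := classSum a₀ x₀ u with hcu
  set cv := classSum a₀ x₀ v with hcv
  set cw := classSum a₀ x₀ w with hcw
  set p := v - u with hp_def
  set q := w - v with hq_def
  have hp : 0 < p := by rw [hp_def]; linarith
  have hq : 0 < q := by rw [hq_def]; linarith
  have huv' : u ≠ v := ne_of_lt huv
  have huw : u ≠ w := ne_of_lt (huv.trans hvw)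
  have hvw' : v ≠ w := ne_of_lt hvw
  have hF0 : ∀ t, expSum a₀ x₀ t = cu * exp (u * t) + cv * exp (v * t) + cw * exp (w * t) :=
    fun t => expSum_eq_three_classes a₀ x₀ u v w huv' huw hvw' honly t
  -- the derivative family `aᵢ(xᵢ − v)`: its limit class sums are `(s − v)·c_s`
  have hG0 : ∀ t, expSum (fun i => a₀ i * (x₀ i - v)) x₀ t = (u - v) * cu * exp (u * t) + (w - v) * cw * exp (w * t) := by
    intro t
    have hcl : ∀ s, classSum (fun i => a₀ i * (x₀ i - v)) x₀ s = (s - v) * classSum a₀ x₀ s := by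
      intro s
      unfold classSum
      rw [Finset.mul_sum]
      refine Finset.sum_congr rfl fun i _ => ?_
      dsimp only
      by_cases h : x₀ i = s
      · rw [if_pos h, if_pos h, h]; ring
      · rw [if_neg h, if_neg h, mul_zero]
    have honly' : ∀ s, classSum (fun i => a₀ i * (x₀ i - v)) x₀ s ≠ 0 → s = u ∨ s = v ∨ s = w := by
      intro s hs
      rw [hcl] at hs
      exact honly s (right_ne_zero_of_mul hs)
    rw [expSum_eq_three_classes _ x₀ u v w huv' huw hvw' honly' t, hcl, hcl, hcl]
    ring
  -- case 1: outer classes of opposite sign ⇒ the derivative limit is zero-free ⇒ eventually ≤ 1 zero: contradiction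
  by_cases hsign : cu * cw < 0
  · exfalso
    have hne : ∀ t ∈ Set.Icc (-R) R, expSum (fun i => a₀ i * (x₀ i - v)) x₀ t ≠ 0 := by
      intro t _ h0
      rw [hG0] at h0
      -- `(u − v)cu` and `(w − v)cw` have the same (non-zero) sign
      have h1 : 0 < (u - v) * cu * ((w - v) * cw) := by
        have : (u - v) * cu * ((w - v) * cw) = -((v - u) * (w - v)) * (cu * cw) := by ring
        rw [this]; exact mul_pos_of_neg_of_neg (by nlinarith) hsign
      have h3 : 0 < (u - v) * cu * exp (u * t) * ((w - v) * cw * exp (w * t)) := by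
        have : (u - v) * cu * exp (u * t) * ((w - v) * cw * exp (w * t)) =
            ((u - v) * cu * ((w - v) * cw)) * (exp (u * t) * exp (w * t)) := by ring
        rw [this]; exact mul_pos h1 (mul_pos (exp_pos _) (exp_pos _))
      have h4 : (u - v) * cu * exp (u * t) = -((w - v) * cw * exp (w * t)) := by linarith
      rw [h4] at h3
      nlinarith [sq_nonneg ((w - v) * cw * exp (w * t))]
    have hev := eventually_card_le_one_of_twistLimit_ne a x a₀ x₀ v ha hx R hne
    obtain ⟨ν, ⟨t₁, t₂, ht₁, ht₂, hne12, h1, h2⟩, hν⟩ := (hfreq.and_eventually hev).exists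
    have := hν {t₁, t₂} (by
      intro z hz
      rw [Finset.mem_insert, Finset.mem_singleton] at hz
      rcases hz with rfl | rfl
      · exact ⟨ht₁, h1⟩
      · exact ⟨ht₂, h2⟩)
    rw [Finset.card_insert_of_notMem (by rwa [Finset.mem_singleton]), Finset.card_singleton] at this
    omega
  -- case 2: outer classes of the same sign; if the inequality failed, the limit would be zero-free ⇒ eventually no zeros: contradiction
  · have hsame : 0 < cu * cw := lt_of_le_of_ne (not_lt.1 hsign) (mul_ne_zero hU hW).symm
    by_contra hcon
    push Not at hcon
    -- expand the target in atoms
    have hpq : 0 < p + q := by linarith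
    have hwu : w - u = p + q := by rw [hp_def, hq_def]; ring
    have hpa : 0 < |cu| := abs_pos.2 hU
    have hpv : 0 < |cv| := abs_pos.2 hV
    have hpw : 0 < |cw| := abs_pos.2 hW
    have L1 : log (|cu| * (p * (w - u))) = log |cu| + log p + log (p + q) := by
      rw [hwu, log_mul hpa.ne' (mul_pos hp hpq).ne', log_mul hp.ne' hpq.ne']; ring
    have L2 : log (|cw| * ((w - u) * q)) = log |cw| + log (p + q) + log q := by
      rw [hwu, log_mul hpw.ne' (mul_pos hpq hq).ne', log_mul hpq.ne' hq.ne']; ring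
    have L3 : log (|cv| * (p * q)) = log |cv| + log p + log q := by
      rw [log_mul hpv.ne' (mul_pos hp hq).ne', log_mul hp.ne' hq.ne']; ring
    rw [L1, L2, L3, hwu] at hcon
    -- the AM–GM bound in atoms: for every `t`, `(p+q) log(|cu|e^{−pt} + |cw|e^{qt}) ≥ …`
    have hbound : ∀ t, (p + q) * (log (p + q) - log p - log q) + q * (log p + log |cu|) + p * (log q + log |cw|) ≤
        (p + q) * log (|cu| * exp (-(p * t)) + |cw| * exp (q * t)) := by
      intro t
      have h := amgm_lower_bound hpa hpw hp hq t
      rw [log_div hpq.ne' (mul_pos hp hq).ne', log_mul hp.ne' hq.ne', log_mul hp.ne' hpa.ne', log_mul hq.ne' hpw.ne'] at h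
      linarith
    -- hence `|cv| < |cu|e^{−pt} + |cw|e^{qt}` for every `t`
    have hlt : ∀ t, |cv| < |cu| * exp (-(p * t)) + |cw| * exp (q * t) := by
      intro t
      have hpos : 0 < |cu| * exp (-(p * t)) + |cw| * exp (q * t) := by positivity
      have h1 : (p + q) * log |cv| < (p + q) * log (|cu| * exp (-(p * t)) + |cw| * exp (q * t)) := by
        have := hbound t; nlinarith [hcon]
      have h2 : log |cv| < log (|cu| * exp (-(p * t)) + |cw| * exp (q * t)) := lt_of_mul_lt_mul_left h1 hpq.le
      exact (log_lt_log_iff hpv hpos).1 h2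
    -- the limit is zero-free on the whole line
    have hne : ∀ t ∈ Set.Icc (-R) R, expSum a₀ x₀ t ≠ 0 := by
      intro t _ h0
      rw [hF0] at h0
      -- twist: `cu e^{−pt} + cw e^{qt} = −cv`
      have htw : cu * exp (-(p * t)) + cw * exp (q * t) = -cv := by
        have hmul := congrArg (fun y => exp (-(v * t)) * y) h0
        simp only [mul_add, mul_zero] at hmul
        have e1 : exp (-(v * t)) * (cu * exp (u * t)) = cu * exp (-(p * t)) := by
          rw [hp_def, show -((v - u) * t) = -(v * t) + u * t by ring, exp_add]; ring
        have e2 : exp (-(v * t)) * (cv * exp (v * t)) = cv := by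
          rw [mul_left_comm, ← exp_add, show -(v * t) + v * t = 0 by ring, exp_zero, mul_one]
        have e3 : exp (-(v * t)) * (cw * exp (w * t)) = cw * exp (q * t) := by
          rw [hq_def, show (w - v) * t = -(v * t) + w * t by ring, exp_add]; ring
        rw [e1, e2, e3] at hmul
        linarith
      have h := hlt t
      rcases lt_or_gt_of_ne hU with hu0 | hu0
      · have hw0 : cw < 0 := by nlinarith
        rw [abs_of_neg hu0, abs_of_neg hw0] at h
        have : |cv| < -(cu * exp (-(p * t)) + cw * exp (q * t)) := by linarith
        rw [htw, neg_neg] at this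
        linarith [le_abs_self cv, neg_abs_le cv]
      · have hw0 : 0 < cw := by nlinarith
        rw [abs_of_pos hu0, abs_of_pos hw0] at h
        rw [htw] at h
        linarith [le_abs_self cv, neg_abs_le cv]
    have hev := eventually_noZero_of_limit_ne a x a₀ x₀ ha hx R hne
    obtain ⟨ν, ⟨t₁, t₂, ht₁, -, -, h1, -⟩, hν⟩ := (hfreq.and_eventually hev).exists
    exact hν t₁ ht₁ h1

end Summit.ValiantsHypothesis.ValiantsHypothesis.Theorems.LacunarySymmetroidMatrixDescartes.WallBubbling.Bubbling
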